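/-
Copyright: statement-level skeleton of a published paper (lit-balaban cell, Phase-2 proof seat p19, gen 3). No claims beyond
what the kernel checks below.
-/
import Mathlib
import Literature.MathematicalPhysics.QuantumFieldTheory.Balaban1983to89.B3Ineq213TreeLength
import Literature.MathematicalPhysics.QuantumFieldTheory.Balaban1983to89.B3Prop1

/-!
# B3 — T. Bałaban, *(Higgs)₂,₃ quantum fields in a finite volume. III. Renormalization*, CMP **88** (1983) 411–445
[Balaban1983Higgs3] — Sect. 3, p. 432: the two geometric sentences of the reduction of (1.33) to (3.2) — the dist-0
components sit in cubes of a size depending on the number of vertices, and the exponential factor of (1.33) comes from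
the external-field estimates (3.1)/(2.5) of the long lines

statement-level skeleton of published theorems with citation tags; proofs where landed; nothing here is a claim about
the Yang–Mills mass gap

PDF held: `paper:balaban1983-higgs-2-3-quantum-fields-finite-volume` (journal page = PDF page + 410); display read on the
×2 render `pub-balaban/b2b-balaban-ref1/pages/1983-cmp88-higgs23-III/1983-cmp88-higgs23-III-p022-x2.png` (p. 432).

Phase-2 contribution to SKELETON row **B3.Eq3.2** (unit `lit-balaban-p19` gen 3, HOME `run/shared/lean/pub/lit-balaban/`;
owner r15; the row's degree sentence *"if we replace a line … the degree of the new graph is greater or equal"* is p18's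
`B3LineCut`), on the gen-3 carriers of `B3Ineq213TreeLength` (unit cubes `□(v)` = scale-`k` cubes of the gen-2
`B3Ineq215.Cube` family at positions `box v`, `η = L^{−k}`; `boxTreeLen L k □` = `d({□(v)}_{v∈G})` of (1.33)).

WHAT IS REPRODUCED.  p. 432 [PDF 22], verbatim: *"Now if two vertices, v, v′ have localizations satisfying dist(□(v), □(v′))
≧ 1, then we consider every propagator corresponding to a line connecting these vertices as an external field also. Such a
possibility is assured by the following estimates ‖hG_k(Ω, B̃)h′‖_{1,α} ≦ O(1)e^{−δ₀dist(□(v),□(v′))}, (3.1) … Thus we can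
represent our expression as a sum of the expressions E(G′_ren, {□(v)}_{v∈G′_ren}, Φ′_ext, A′_ext), with the property that each
line of each connected component of G′_ren is localized in cubes □(v), □(v′) with dist(□(v), □(v′)) = 0 … From this it
follows that the localizations of each connected component are contained in some cube of a linear size depending on a number
of vertices, hence on n̄ only. To prove (1.33) it is sufficient to prove the estimates |E(G′_ren, {□(v)}_{v∈G′_ren}, Φ′_ext,
A′_ext)| ≦ O(1)(e(L^kε))^{d_v(G′_ren)}(λ(L^kε))^{d_s(G′_ren)}‖Φ′_ext‖_{1,α₀}‖A′_ext‖_{1,α₀}, (3.2) because these estimates and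
(2.5), (3.1) imply (1.33), and the exponential factor in (1.33) is obtained from the estimates of external fields in (3.2)."*
KERNEL-CHECKED HERE (the two geometric facts and the bookkeeping; (2.5), (3.1), (3.2) themselves are analytic inputs and
are NOT asserted):
(i) `supDist_box_le_of_shortLines`: if the lines of a CONNECTED graph all join unit cubes at distance `0`, then any two of
its cubes `□(u)`, `□(w)` are at most `|V| − 1` unit cubes apart in every coordinate — *"the localizations of each connected
component are contained in some cube of a linear size depending on a number of vertices"* (a path of fewer than `|V|`
lines, `SimpleGraph.Walk.bypass`, each moving the cube by at most one);
(ii) `prod_exp_boxDistI_le`: for a connected graph `Π_{lines l} exp[−δ₀dist(□(v_l), □(v′_l))] ≤ e^{2mδ₀} exp[−δ₀d({□(v)})]`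
(a localized point of `□(u)` and one of `□(w)` are at most `dist(□(u), □(w)) + 2` apart, `supDist_le_distI_add`, and
`d({□(v)}) ≤ η Σ_l |x_{v_l} − x_{v′_l}|_∞`, `B3Ineq213TreeLength.boxTreeLen_le_sum_lines`);
and the ASSEMBLY `bound133_of_bound32`: if `|E| ≤ B · ‖Φ′_ext‖‖A′_ext‖ · Π_{long l} N_l` (the shape of (3.2) for `G′`, whose
extra external fields are the pairs replacing the long lines, of norms `N_l`), `N_l ≤ c_l e^{−δ₀dist(□(v_l),□(v′_l))}`
((3.1)/(2.5)) and the remaining (short) lines have `dist = 0`, then `|E| ≤ B (Π_{long} c_l) e^{2mδ₀} exp[−δ₀ d({□(v)})]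
‖Φ′_ext‖‖A′_ext‖` — the shape (1.33), the constant `e^{2mδ₀}` (`m` = number of lines, a function of n̄) being part of the
printed O(1).  Reading choices as in the gen-2/gen-3 files: sup-norm distances on `ηℤ^d` in η-units, `dist(□, □′)` = the
gen-2 `Cube.distI`.  Nothing of the paper beyond these sentences is asserted.
-/

open Finset

namespace Literature.MathematicalPhysics.QuantumFieldTheory.Balaban1983to89.B3Eq32ExpFactor

open B3Ineq215 B3Ineq213

variable {d : ℕ} {L : ℕ}

/-! ## Points of a cube and distances of cubes -/

/-- A lattice point of a cube lies between its corners, coordinatewise. [cite: Balaban1983Higgs3, (3.1) p.432] -/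
theorem lo_le_and_lt_hi (hL : 0 < L) {A : Cube d} {x : Fin d → ℕ} (hx : x ∈ pts L A) (μ : Fin d) :
    A.lo L μ ≤ x μ ∧ x μ < A.hi L μ := by
  have h := (Cube.mem_desc_iff hL).1 ((mem_pts_iff hL).1 hx)
  have hq : 0 < L ^ A.s := pow_pos hL _
  have e : x μ / L ^ A.s = A.z μ := by simpa using h.2 μ
  unfold Cube.lo Cube.hi
  constructor
  · have h1 := (Nat.le_div_iff_mul_le hq).1 e.ge
    rw [mul_comm] at h1
    exact h1
  · have h2 := (Nat.div_lt_iff_lt_mul hq).1 (Nat.lt_succ_iff.2 e.le)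
    rw [mul_comm] at h2
    exact h2

/-- Two localized points are at most `dist(A, B) + side(A) + side(B)` apart, coordinatewise.
[cite: Balaban1983Higgs3, (3.1) p.432] -/
theorem dist_le_gap_add (hL : 0 < L) {A B : Cube d} {x y : Fin d → ℕ} (hx : x ∈ pts L A) (hy : y ∈ pts L B)
    (μ : Fin d) : Nat.dist (x μ) (y μ) ≤ Cube.gap L A B μ + L ^ A.s + L ^ B.s := by
  obtain ⟨hx1, hx2⟩ := lo_le_and_lt_hi hL hx μ
  obtain ⟨hy1, hy2⟩ := lo_le_and_lt_hi hL hy μ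
  have hA := Cube.hi_eq L A μ
  have hB := Cube.hi_eq L B μ
  have h1 : A.lo L μ - B.hi L μ ≤ Cube.gap L A B μ := le_max_left _ _
  have h2 : B.lo L μ - A.hi L μ ≤ Cube.gap L A B μ := le_max_right _ _
  unfold Nat.dist
  omega

/-- **Localized points vs. cube distance**: for `x ∈ A`, `y ∈ B`, `|x − y|_∞ ≤ dist(A, B) + L^{s(A)} + L^{s(B)}` (η-units);
for unit cubes (side `L^k η = 1`) this is `|x − y| ≤ dist(□(u), □(w)) + 2`. [cite: Balaban1983Higgs3, (3.1) p.432] -/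
theorem supDist_le_distI_add (hL : 0 < L) {A B : Cube d} {x y : Fin d → ℕ} (hx : x ∈ pts L A) (hy : y ∈ pts L B) :
    supDist x y ≤ Cube.distI L A B + L ^ A.s + L ^ B.s := by
  unfold supDist
  refine Finset.sup_le fun μ _ => (dist_le_gap_add hL hx hy μ).trans ?_
  have := Cube.gap_le_distI (L := L) A B μ
  omega

/-- Unit cubes (same scale) at distance `0` have positions differing by at most one, coordinatewise.
[cite: Balaban1983Higgs3, (3.2) p.432] -/
theorem supDist_le_one_of_distI_eq_zero (hL : 0 < L) {k : ℕ} {bu bw : Fin d → ℕ}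
    (h : Cube.distI L (⟨k, bu⟩ : Cube d) ⟨k, bw⟩ = 0) : supDist bu bw ≤ 1 := by
  unfold supDist
  refine Finset.sup_le fun μ _ => ?_
  have hg : Cube.gap L (⟨k, bu⟩ : Cube d) ⟨k, bw⟩ μ = 0 := by
    have := Cube.gap_le_distI (L := L) (⟨k, bu⟩ : Cube d) ⟨k, bw⟩ μ
    omega
  have hq : 0 < L ^ k := pow_pos hL k
  have h1 : L ^ k * bu μ - L ^ k * (bw μ + 1) = 0 :=
    Nat.eq_zero_of_le_zero ((le_max_left _ _).trans hg.le)
  have h2 : L ^ k * bw μ - L ^ k * (bu μ + 1) = 0 :=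
    Nat.eq_zero_of_le_zero ((le_max_right _ _).trans hg.le)
  have h1' : bu μ ≤ bw μ + 1 := Nat.le_of_mul_le_mul_left (Nat.sub_eq_zero_iff_le.1 h1) hq
  have h2' : bw μ ≤ bu μ + 1 := Nat.le_of_mul_le_mul_left (Nat.sub_eq_zero_iff_le.1 h2) hq
  unfold Nat.dist
  omega

/-- Triangle inequality for the sup-distance. [cite: Balaban1983Higgs3, (3.2) p.432] -/
theorem supDist_triangle (x y z : Fin d → ℕ) : supDist x z ≤ supDist x y + supDist y z := by
  unfold supDist
  refine Finset.sup_le fun μ _ => (Nat.dist.triangle_inequality (x μ) (y μ) (z μ)).trans ?_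
  exact add_le_add (le_sup (f := fun μ => Nat.dist (x μ) (y μ)) (mem_univ μ))
    (le_sup (f := fun μ => Nat.dist (y μ) (z μ)) (mem_univ μ))

/-! ## (ii) the exponential factor of (1.33) from the long lines -/

section Lines

variable {V : Type*} {m : ℕ}

/-- `dist(□(u), □(w))` in η-units for the unit cubes `□(v)` (scale `k`, positions `box v`).
[cite: Balaban1983Higgs3, (3.1) p.432] -/
def boxDistI (L k : ℕ) (box : V → Fin d → ℕ) (u w : V) : ℕ :=
  Cube.distI L (⟨k, box u⟩ : Cube d) ⟨k, box w⟩

/-- Unfolding `boxDistI`. [cite: Balaban1983Higgs3, (3.1) p.432] -/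
theorem boxDistI_eq (L k : ℕ) (box : V → Fin d → ℕ) (u w : V) :
    boxDistI L k box u w = Cube.distI L (⟨k, box u⟩ : Cube d) ⟨k, box w⟩ := rfl

/-- The LONG lines of a placement `{□(v)}`: `dist(□(v_l), □(v′_l)) ≥ 1` — p. 432: *"if two vertices, v, v′ have localizations
satisfying dist(□(v), □(v′)) ≥ 1, then we consider every propagator corresponding to a line connecting these vertices as
an external field also"*. [cite: Balaban1983Higgs3, (3.1) p.432] -/
def longLines (L k : ℕ) (box : V → Fin d → ℕ) (src tgt : Fin m → V) : Finset (Fin m) :=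
  univ.filter fun l => 1 ≤ boxDistI L k box (src l) (tgt l)

/-- Membership in `longLines`. [cite: Balaban1983Higgs3, (3.1) p.432] -/
theorem mem_longLines {L k : ℕ} {box : V → Fin d → ℕ} {src tgt : Fin m → V} {l : Fin m} :
    l ∈ longLines L k box src tgt ↔ 1 ≤ boxDistI L k box (src l) (tgt l) := by
  simp [longLines]

/-- The other (short) lines join cubes at distance `0`. [cite: Balaban1983Higgs3, (3.2) p.432] -/
theorem boxDistI_eq_zero_of_not_mem_longLines {L k : ℕ} {box : V → Fin d → ℕ} {src tgt : Fin m → V} {l : Fin m}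
    (hl : l ∉ longLines L k box src tgt) : boxDistI L k box (src l) (tgt l) = 0 := by
  rw [mem_longLines] at hl
  omega

variable [Fintype V] [DecidableEq V]

/-- For a connected graph, `d({□(v)}) ≤ η Σ_{lines} dist(□(v_l), □(v′_l)) + 2m` (`m` = number of lines): the tree length of
any localized position tuple is at most the sum over the lines of `η|x_{v_l} − x_{v′_l}|_∞`
(`B3Ineq213TreeLength.boxTreeLen_le_sum_lines`), and `η|x_u − x_w|_∞ ≤ η dist(□(u), □(w)) + 2`.
[cite: Balaban1983Higgs3, (3.2) p.432] -/
theorem boxTreeLen_le_sum_boxDistI (hL : 0 < L) {k : ℕ} {box : V → Fin d → ℕ} {src tgt : Fin m → V}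
    (h : LinesConnect src tgt) :
    boxTreeLen L k box ≤ ((L : ℝ) ^ k)⁻¹ * (∑ l, (boxDistI L k box (src l) (tgt l) : ℝ)) + 2 * m := by
  obtain ⟨x, hx⟩ := boxPositions_nonempty hL k box
  have hxv : ∀ v, x v ∈ pts L (⟨k, box v⟩ : Cube d) := mem_boxPositions.1 hx
  have hLk : (0 : ℝ) < (L : ℝ) ^ k := by positivity
  have hm : ((L : ℝ) ^ k)⁻¹ * ((m : ℝ) * (2 * (L : ℝ) ^ k)) = 2 * m := by
    have hc : ((L : ℝ) ^ k)⁻¹ * (L : ℝ) ^ k = 1 := inv_mul_cancel₀ hLk.ne'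
    calc ((L : ℝ) ^ k)⁻¹ * ((m : ℝ) * (2 * (L : ℝ) ^ k)) = 2 * m * (((L : ℝ) ^ k)⁻¹ * (L : ℝ) ^ k) := by ring
      _ = 2 * m := by rw [hc, mul_one]
  have hstep : ∀ l, (supDist (x (src l)) (x (tgt l)) : ℝ)
      ≤ (boxDistI L k box (src l) (tgt l) : ℝ) + 2 * (L : ℝ) ^ k := by
    intro l
    have h1 : supDist (x (src l)) (x (tgt l)) ≤ boxDistI L k box (src l) (tgt l) + L ^ k + L ^ k :=
      supDist_le_distI_add hL (hxv (src l)) (hxv (tgt l))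
    have h2 : ((boxDistI L k box (src l) (tgt l) + L ^ k + L ^ k : ℕ) : ℝ)
        = (boxDistI L k box (src l) (tgt l) : ℝ) + 2 * (L : ℝ) ^ k := by
      push_cast
      ring
    calc (supDist (x (src l)) (x (tgt l)) : ℝ) ≤ ((boxDistI L k box (src l) (tgt l) + L ^ k + L ^ k : ℕ) : ℝ) := by
          exact_mod_cast h1
      _ = _ := h2
  calc boxTreeLen L k box ≤ ((L : ℝ) ^ k)⁻¹ * ∑ l, (supDist (x (src l)) (x (tgt l)) : ℝ) :=
        boxTreeLen_le_sum_lines h hx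
    _ ≤ ((L : ℝ) ^ k)⁻¹ * ∑ l, ((boxDistI L k box (src l) (tgt l) : ℝ) + 2 * (L : ℝ) ^ k) :=
        mul_le_mul_of_nonneg_left (sum_le_sum fun l _ => hstep l) (inv_nonneg.2 hLk.le)
    _ = ((L : ℝ) ^ k)⁻¹ * (∑ l, (boxDistI L k box (src l) (tgt l) : ℝ)) + 2 * m := by
        rw [sum_add_distrib, sum_const, card_univ, Fintype.card_fin, nsmul_eq_mul, mul_add, hm]

/-- p. 432: *"the exponential factor in (1.33) is obtained from the estimates of external fields"* — for a connected graph,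
`Π_{lines l} exp[−δ₀ dist(□(v_l), □(v′_l))] ≤ e^{2mδ₀} exp[−δ₀ d({□(v)})]` (`dist` in unit-lattice units = `η · distI`,
`δ₀ ≥ 0`). [cite: Balaban1983Higgs3, (3.2) p.432] -/
theorem prod_exp_boxDistI_le (hL : 0 < L) {k : ℕ} {box : V → Fin d → ℕ} {src tgt : Fin m → V}
    (h : LinesConnect src tgt) {δ₀ : ℝ} (hδ : 0 ≤ δ₀) :
    ∏ l, Real.exp (-(δ₀ * (((L : ℝ) ^ k)⁻¹ * (boxDistI L k box (src l) (tgt l) : ℝ))))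
      ≤ Real.exp (2 * m * δ₀) * Real.exp (-(δ₀ * boxTreeLen L k box)) := by
  rw [← Real.exp_sum, ← Real.exp_add]
  apply Real.exp_le_exp.2
  have ht := boxTreeLen_le_sum_boxDistI (L := L) (k := k) (box := box) hL h
  have e : ∑ l, -(δ₀ * (((L : ℝ) ^ k)⁻¹ * (boxDistI L k box (src l) (tgt l) : ℝ)))
      = -(δ₀ * (((L : ℝ) ^ k)⁻¹ * ∑ l, (boxDistI L k box (src l) (tgt l) : ℝ))) := by
    rw [mul_sum, mul_sum, ← sum_neg_distrib]
  rw [e]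
  nlinarith

/-- **(3.2) ∧ (2.5) ∧ (3.1) ⇒ (1.33), the bookkeeping** (p. 432: *"because these estimates and (2.5), (3.1) imply (1.33),
and the exponential factor in (1.33) is obtained from the estimates of external fields in (3.2)"*): if the expression, with
the long lines (the set `long`, `dist(□(v), □(v′)) ≥ 1`) turned into pairs of external fields of norms `N_l`, obeys a bound
of the shape (3.2), `|E| ≤ B · ‖Φ′_ext‖‖A′_ext‖ · Π_{l∈long} N_l`, the norms obey (3.1)/(2.5), `N_l ≤
c_l e^{−δ₀dist(□(v_l),□(v′_l))}`, and the remaining lines are short (`dist = 0`), then for a connected graph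
`|E| ≤ B (Π_{long} c_l) e^{2mδ₀} · exp[−δ₀ d({□(v)})] · ‖Φ′_ext‖‖A′_ext‖`. [cite: Balaban1983Higgs3, (3.2) p.432] -/
theorem bound133_of_bound32 (hL : 0 < L) {k : ℕ} {box : V → Fin d → ℕ} {src tgt : Fin m → V}
    (h : LinesConnect src tgt) {δ₀ : ℝ} (hδ : 0 ≤ δ₀) {E B nΦ nA : ℝ} (hB : 0 ≤ B) (hΦ : 0 ≤ nΦ) (hA : 0 ≤ nA)
    {long : Finset (Fin m)} {N c : Fin m → ℝ} (hN0 : ∀ l ∈ long, 0 ≤ N l)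
    (hE : |E| ≤ B * nΦ * nA * ∏ l ∈ long, N l)
    (hN : ∀ l ∈ long, N l ≤ c l * Real.exp (-(δ₀ * (((L : ℝ) ^ k)⁻¹ * (boxDistI L k box (src l) (tgt l) : ℝ)))))
    (hshort : ∀ l, l ∉ long → boxDistI L k box (src l) (tgt l) = 0) :
    |E| ≤ B * (∏ l ∈ long, c l) * Real.exp (2 * m * δ₀) * Real.exp (-(δ₀ * boxTreeLen L k box)) * nΦ * nA := by
  -- the constants of the long lines are non-negative (each dominates a norm)
  have hc0 : ∀ l ∈ long, 0 ≤ c l := fun l hl =>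
    (mul_nonneg_iff_of_pos_right (Real.exp_pos _)).1 ((hN0 l hl).trans (hN l hl))
  -- the product of the norms of the long lines
  have hprodN : ∏ l ∈ long, N l
      ≤ (∏ l ∈ long, c l)
        * ∏ l ∈ long, Real.exp (-(δ₀ * (((L : ℝ) ^ k)⁻¹ * (boxDistI L k box (src l) (tgt l) : ℝ)))) := by
    rw [← prod_mul_distrib]
    exact prod_le_prod hN0 hN
  -- the short lines contribute factors 1: the product over `long` is the product over all lines
  have hall : ∏ l ∈ long, Real.exp (-(δ₀ * (((L : ℝ) ^ k)⁻¹ * (boxDistI L k box (src l) (tgt l) : ℝ))))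
      = ∏ l, Real.exp (-(δ₀ * (((L : ℝ) ^ k)⁻¹ * (boxDistI L k box (src l) (tgt l) : ℝ)))) := by
    apply prod_subset (subset_univ _)
    intro l _ hl
    rw [hshort l hl]
    simp
  have hexp := prod_exp_boxDistI_le (L := L) (k := k) (box := box) hL h hδ
  have hc : 0 ≤ ∏ l ∈ long, c l := prod_nonneg hc0
  calc |E| ≤ B * nΦ * nA * ∏ l ∈ long, N l := hE
    _ ≤ B * nΦ * nA
          * ((∏ l ∈ long, c l) * (Real.exp (2 * m * δ₀) * Real.exp (-(δ₀ * boxTreeLen L k box)))) := by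
        refine mul_le_mul_of_nonneg_left (hprodN.trans ?_) (by positivity)
        rw [hall]
        exact mul_le_mul_of_nonneg_left hexp hc
    _ = _ := by ring

end Lines

/-! ## (i) the dist-0 components sit in cubes of a size depending on the number of vertices -/

section Components

variable {V : Type*} {m : ℕ}

/-- The graph on the vertices whose edges are the lines (as a `SimpleGraph`: orientation and multiplicity forgotten,
loops dropped). [cite: Balaban1983Higgs3, (3.2) p.432] -/
def lineGraph (src tgt : Fin m → V) : SimpleGraph V :=
  SimpleGraph.fromRel fun a b => ∃ l, src l = a ∧ tgt l = b

/-- Adjacency in the line graph. [cite: Balaban1983Higgs3, (3.2) p.432] -/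
theorem lineGraph_adj {src tgt : Fin m → V} {a b : V} :
    (lineGraph src tgt).Adj a b ↔ a ≠ b ∧ ((∃ l, src l = a ∧ tgt l = b) ∨ ∃ l, src l = b ∧ tgt l = a) :=
  Iff.rfl

/-- A connecting line set makes every two vertices reachable in the line graph. [cite: Balaban1983Higgs3, (3.2) p.432] -/
theorem reachable_of_linesConnect {src tgt : Fin m → V} (h : LinesConnect src tgt) (u w : V) :
    (lineGraph src tgt).Reachable u w := by
  induction h u w with
  | rel a b hab =>
      by_cases heq : a = b
      · subst heq
        exact SimpleGraph.Reachable.refl _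
      · exact SimpleGraph.Adj.reachable (lineGraph_adj.2 ⟨heq, Or.inl hab⟩)
  | refl a => exact SimpleGraph.Reachable.refl _
  | symm a b _ ih => exact ih.symm
  | trans a b c _ _ ih1 ih2 => exact ih1.trans ih2

/-- Along a walk each of whose edges moves the cube by at most one, the cubes of the endpoints differ by at most the
length of the walk. [cite: Balaban1983Higgs3, (3.2) p.432] -/
theorem supDist_le_length {Gr : SimpleGraph V} {box : V → Fin d → ℕ}
    (hadj : ∀ a b, Gr.Adj a b → supDist (box a) (box b) ≤ 1) {u w : V} (p : Gr.Walk u w) :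
    supDist (box u) (box w) ≤ p.length := by
  induction p with
  | nil => simp [supDist_self]
  | @cons a b c hab p ih =>
      rw [SimpleGraph.Walk.length_cons]
      calc supDist (box a) (box c) ≤ supDist (box a) (box b) + supDist (box b) (box c) := supDist_triangle _ _ _
        _ ≤ 1 + p.length := add_le_add (hadj a b hab) ih
        _ = p.length + 1 := add_comm _ _

/-- **p. 432, the cube containing a dist-0 component**: if the graph is connected and every line joins unit cubes at
distance `0` (*"each line of each connected component of G′_ren is localized in cubes □(v), □(v′) with dist(□(v), □(v′))
= 0"*), then any two of its cubes are at most `|V| − 1` unit cubes apart in every coordinate — *"the localizations of each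
connected component are contained in some cube of a linear size depending on a number of vertices, hence on n̄ only"* (the
cube of `2|V| − 1` unit cubes a side centred at any `□(v₀)`). [cite: Balaban1983Higgs3, (3.2) p.432] -/
theorem supDist_box_le_of_shortLines [Fintype V] (hL : 0 < L) {k : ℕ} {box : V → Fin d → ℕ} {src tgt : Fin m → V}
    (h : LinesConnect src tgt) (hshort : ∀ l, boxDistI L k box (src l) (tgt l) = 0) (u w : V) :
    supDist (box u) (box w) ≤ Fintype.card V - 1 := by
  classical
  have hadj : ∀ a b, (lineGraph src tgt).Adj a b → supDist (box a) (box b) ≤ 1 := by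
    intro a b hab
    obtain ⟨-, hl | hl⟩ := lineGraph_adj.1 hab
    · obtain ⟨l, rfl, rfl⟩ := hl
      have h0 : Cube.distI L (⟨k, box (src l)⟩ : Cube d) ⟨k, box (tgt l)⟩ = 0 := hshort l
      exact supDist_le_one_of_distI_eq_zero hL h0
    · obtain ⟨l, rfl, rfl⟩ := hl
      have h0 : Cube.distI L (⟨k, box (src l)⟩ : Cube d) ⟨k, box (tgt l)⟩ = 0 := hshort l
      rw [supDist_comm]
      exact supDist_le_one_of_distI_eq_zero hL h0
  obtain ⟨p⟩ := reachable_of_linesConnect h u w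
  have hlen : p.bypass.length < Fintype.card V := p.bypass_isPath.length_lt
  have hle := supDist_le_length hadj p.bypass
  omega

end Components

/-! ## BY NAME: r15's (1.33) carrier `B3Prop1.Ineq133At` from bounds of the shapes (3.2) and (3.1)/(2.5) -/

section ByName

open B3Prop1

variable {V : Type} {m : ℕ}

/-- The data of the p. 432 reduction for ONE connected renormalized class with `m` lines `src l → tgt l` on the vertex
set `V`, at scale `k` (`η = L^{−k}`): the expression `E(G_ren, {□(v)}, Φ_ext, A_ext)` as a function of the placement
`{□(v)}` (positions `box v` of the unit cubes) and of the external fields, its orders `d_v`, `d_s`, the running couplings,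
the norms `‖hΦ_ext‖_{1,α}`, `‖h′A_ext‖_{1,α}`, and the norms `N({□(v)}, l)` = `‖h_{v_l} G_k h′_{v′_l}‖_{1,α₀}` of the line
propagators regarded as external fields (p. 432).  Carrier clauses: all of these are data of the instance.
[cite: Balaban1983Higgs3, (3.1)–(3.2) p.432] -/
structure Surgery (d : ℕ) (V : Type) (m : ℕ) where
  /-- initial vertices `v_l` of the lines -/
  src : Fin m → V
  /-- final vertices `v′_l` of the lines -/
  tgt : Fin m → V
  /-- the class is connected -/
  conn : LinesConnect src tgt
  /-- the block-spin parameter `L` -/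
  L : ℕ
  /-- the scale: `η = L^{−k}` -/
  k : ℕ
  L_pos : 0 < L
  /-- e(L^kε) -/
  eRun : ℝ
  /-- λ(L^kε) -/
  lamRun : ℝ
  eRun_pos : 0 < eRun
  lamRun_pos : 0 < lamRun
  /-- d_v(G_ren) -/
  dv : ℕ
  /-- d_s(G_ren) -/
  ds : ℕ
  /-- external scalar fields Φ_ext -/
  ExtS : Type
  /-- external vector fields A_ext -/
  ExtV : Type
  /-- E(G_ren, {□(v)}, Φ_ext, A_ext) -/
  E : (V → Fin d → ℕ) → ExtS → ExtV → ℝ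
  /-- α ↦ ‖hΦ_ext‖_{1,α} at the placement -/
  normS : ℝ → (V → Fin d → ℕ) → ExtS → ℝ
  /-- α ↦ ‖h′A_ext‖_{1,α} at the placement -/
  normV : ℝ → (V → Fin d → ℕ) → ExtV → ℝ
  normS_nonneg : ∀ α box Φ, 0 ≤ normS α box Φ
  normV_nonneg : ∀ α box A, 0 ≤ normV α box A
  /-- the norms ‖h_{v_l} G_k(Ω, B̃) h′_{v′_l}‖_{1,α₀} of the line propagators as external fields, at the placement -/
  N : (V → Fin d → ℕ) → Fin m → ℝ
  N_nonneg : ∀ box l, 0 ≤ N box l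

variable [Fintype V] [DecidableEq V]

/-- The datum of r15's carrier `B3Prop1.Expansion` it defines: one renormalized class (`RenClass = Unit`), localizations =
placements of the unit cubes, `d({□(v)})` = `boxTreeLen` (the gen-3 reading of *"a length of a shortest tree graph connecting
the vertices v localized in □(v)"*). [cite: Balaban1983Higgs3, (1.33) p.420] -/
noncomputable def Surgery.toExpansion (S : Surgery d V m) : Expansion where
  eRun := S.eRun
  lamRun := S.lamRun
  eRun_pos := S.eRun_pos
  lamRun_pos := S.lamRun_pos
  RenClass := Unit
  Loc := fun _ => V → Fin d → ℕ
  ExtS := S.ExtS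
  ExtV := S.ExtV
  E := fun _ box Φ A => S.E box Φ A
  ds := fun _ => S.ds
  dv := fun _ => S.dv
  treeLen := fun _ box => boxTreeLen S.L S.k box
  treeLen_nonneg := fun _ box => boxTreeLen_nonneg S.L S.k box
  normS := fun α _ box Φ => S.normS α box Φ
  normV := fun α _ box A => S.normV α box A
  normS_nonneg := fun α _ box Φ => S.normS_nonneg α box Φ
  normV_nonneg := fun α _ box A => S.normV_nonneg α box A

/-- **p. 432, "(3.2) [and] (2.5), (3.1) imply (1.33)" — r15's `Ineq133At` INHABITED from bounds of the printed shapes**: if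
at every placement the expression obeys the bound of the shape (3.2) for the graph `G′` whose long lines (`longLines`,
`dist ≥ 1`) are pairs of external fields — `|E| ≤ C e^{d_v} λ^{d_s} ‖hΦ_ext‖_{1,α₀}‖h′A_ext‖_{1,α₀} Π_{long l} N_l` — and the
long-line norms obey the shape (3.1)/(2.5), `N_l ≤ C′ exp[−δ₀ dist(□(v_l), □(v′_l))]` (`δ₀ ≥ 0`), then (1.33) holds for the
class at `(α₀, δ₀, O(1) = C · max(1, C′)^m · e^{2mδ₀})`, for all placements and all external fields.
[cite: Balaban1983Higgs3, (3.2) p.432] -/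
theorem Surgery.ineq133At (S : Surgery d V m) {α₀ δ₀ C C' : ℝ} (hδ : 0 ≤ δ₀) (hC : 0 ≤ C)
    (h32 : ∀ (box : V → Fin d → ℕ) (Φ : S.ExtS) (A : S.ExtV),
      |S.E box Φ A| ≤ C * S.eRun ^ S.dv * S.lamRun ^ S.ds * S.normS α₀ box Φ * S.normV α₀ box A
        * ∏ l ∈ longLines S.L S.k box S.src S.tgt, S.N box l)
    (h31 : ∀ (box : V → Fin d → ℕ) (l : Fin m), 1 ≤ boxDistI S.L S.k box (S.src l) (S.tgt l) →
      S.N box l ≤ C' * Real.exp (-(δ₀ * (((S.L : ℝ) ^ S.k)⁻¹ * (boxDistI S.L S.k box (S.src l) (S.tgt l) : ℝ))))) :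
    Ineq133At S.toExpansion () α₀ δ₀ (C * max 1 C' ^ m * Real.exp (2 * m * δ₀)) := by
  intro box Φ A
  have he := S.eRun_pos
  have hl := S.lamRun_pos
  have hΦ := S.normS_nonneg α₀ box Φ
  have hA := S.normV_nonneg α₀ box A
  have hB : 0 ≤ C * S.eRun ^ S.dv * S.lamRun ^ S.ds := by positivity
  have hmain := bound133_of_bound32 S.L_pos S.conn hδ hB hΦ hA (fun l _ => S.N_nonneg box l) (h32 box Φ A)
    (fun l hl => h31 box l (mem_longLines.1 hl)) (fun l hl => boxDistI_eq_zero_of_not_mem_longLines hl)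
  -- the constant: `Π_{long} C′ ≤ max(1, C′)^m`
  have hc0 : ∀ l ∈ longLines S.L S.k box S.src S.tgt, (0 : ℝ) ≤ C' := fun l hl =>
    (mul_nonneg_iff_of_pos_right (Real.exp_pos _)).1 ((S.N_nonneg box l).trans (h31 box l (mem_longLines.1 hl)))
  have hP : ∏ _l ∈ longLines S.L S.k box S.src S.tgt, C' ≤ max 1 C' ^ m := by
    calc ∏ _l ∈ longLines S.L S.k box S.src S.tgt, C' ≤ ∏ _l ∈ longLines S.L S.k box S.src S.tgt, max 1 C' :=
          prod_le_prod hc0 fun _ _ => le_max_right _ _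
      _ = max 1 C' ^ (longLines S.L S.k box S.src S.tgt).card := prod_const _
      _ ≤ max 1 C' ^ m := by
          refine pow_le_pow_right₀ (le_max_left _ _) ?_
          exact (card_le_univ _).trans_eq (Fintype.card_fin m)
  have hX : 0 ≤ Real.exp (2 * m * δ₀) := (Real.exp_pos _).le
  have hY : 0 ≤ Real.exp (-(δ₀ * boxTreeLen S.L S.k box)) := (Real.exp_pos _).le
  have h1 := mul_le_mul_of_nonneg_left hP hB
  have h2 := mul_le_mul_of_nonneg_right (mul_le_mul_of_nonneg_right
    (mul_le_mul_of_nonneg_right (mul_le_mul_of_nonneg_right h1 hX) hY) hΦ) hA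
  show |S.E box Φ A| ≤ C * max 1 C' ^ m * Real.exp (2 * m * δ₀) * S.eRun ^ S.dv * S.lamRun ^ S.ds
      * Real.exp (-(δ₀ * boxTreeLen S.L S.k box)) * S.normS α₀ box Φ * S.normV α₀ box A
  refine (hmain.trans h2).trans_eq ?_
  ring

end ByName

end Literature.MathematicalPhysics.QuantumFieldTheory.Balaban1983to89.B3Eq32ExpFactor
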